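import Literature.MathematicalPhysics.QuantumFieldTheory.Balaban1983to89.B9Thm311SmallFieldCoercivity
import Literature.MathematicalPhysics.QuantumFieldTheory.Balaban1983to89.B9Eq319QprimeLipschitz
import Literature.MathematicalPhysics.QuantumFieldTheory.Balaban1983to89.B9Eq315QLipschitz

/-!
# `Balaban1983to89.B9Thm311SmallFieldClosed` — T. Bałaban, *Propagators for lattice gauge theories in a background field*, Commun. Math. Phys.
# **99** (1985) 389–434 [Balaban1985BackgroundPropagators] Thm 3.11 p. 416 *«the operators Δ′_a, G′, (Q′G′²Q′*)⁻¹, Δ_a, G are positive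
# definite»*: THEOREM 3.11 FOR THE pub-balaban NE9 CHAIN'S ASSEMBLED `Δ_a(U)` AT EVERY SMALL FIELD `U`, AT A FIXED LATTICE — the displayed `hpos`
# of `B9Eq315QTorus.laplaceAofBackground` / `Support/NE9CurChartOfBackground` IS A THEOREM for `‖U(b) − 1‖ ≤ ε ≤ ε₃` (given the mutual adjointness
# of the transporters and the trace/fibre letters); the junction of the owner's gen-80 files with the NE9 leaves' averaging remainders

statement-level skeleton of published theorems with citation tags; proofs where landed; nothing here is a claim about the Yang–Mills mass gap

PDF held: `paper:balaban1985-cmp99-background-propagators` (journal page = PDF page + 388), pp. 390–391, 396, 404–407, 416 read by this seat (2026-08-22).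

THE PRINT (verbatim).  p. 416: *«Theorem 3.11. Under the assumptions of the Theorems 3.1–3.10 (i.e. for M sufficiently large and α₀ sufficiently
small) the operators Δ′_a, G′, (Q′G′²Q′*)⁻¹, Δ_a, G are positive definite. … by (3.86) we get G_□(e^{iηA}) = G_□(1)(I − V(A)G_□(1))⁻¹. In [4] we have
proved that the operator G_□(1) is positive, hence by the same reasoning as above we prove positivity of G_□.»*  p. 396, (3.35): *«|U(∂p) − 1| <
α₀η² for p ⊂ Ω_j»*.  p. 392: *«the operator Δ′ will be a bounded, small operator, which will be treated as a small perturbation of D*D.»*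

WHY THIS FILE (cell context).  `B9Thm311SmallFieldCoercivity.exists_coercive_principal_of_small_field` (owner gen 80) proves the coercivity of the
chain's PRINCIPAL gauge-fixed operator at every small field modulo two displayed averaging remainders; the NE9 leaves discharged both within the
hour on the owner's OFFER O-ne9p1-g80-1: `B9Eq319QprimeLipschitz.norm_QprimeW_sub_flat_le_L2` (ne9-leaf-03 gen 57: `ρ′ = ((1+εR)^{d(L−1)} − 1)/√c₀`)
and `B9Eq315QLipschitz.norm_QtorusW_sub_flat_le` (ne9-leaf-04 gen 68: `δ_Q = M_φ′M_φ√(c₁·#bonds/c₀)·102(d+1)²L·ε`).  This file plugs them in (§2)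
and then adds the curvature part `Δ′(U)` (`B9Ineq369CurvatureSmall`, owner gen 78) with the plaquette smallness READ OFF the bond smallness (§1),
giving Thm 3.11 for the chain's full assembled `Δ_a(U) = Δ(U) + DR(U)D* + aQ(U)*Q(U)` (§3) — the `hpos` that every NE9 letter (`G₁`, `H₁`, `𝔊`,
the chart of `cur U`) displays.

WHAT IS PROVED (sorry-free; no `Prop` placeholder; no inequality of the paper asserted as a hypothesis-free fact).
* §1 `norm_mul_sub_one_le`, **`norm_plaqHolU_sub_one_le`** (`‖U(∂p) − 1‖ ≤ 4ε` when `‖U(b) − 1‖ ≤ ε`, `U(b) ∈ U1`).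
* §2 **`exists_coercive_principal_of_small_field₀`**: `∃ γ ε₂ > 0` such that for every background `U` of E162's data with `‖U(b) − 1‖ ≤ ε ≤ ε₂` and
  `hRS`: `γ‖x‖² ≤ re⟨x, (D*D + DR(U)D* + aQ(U)*Q(U))x⟩` — NO displayed remainder (`U(b) ∈ U1` read off `hU1` by `B9Eq315QTorusOnto.perSite_liftSite`).
* §3 **`laplaceAofBackground_pos_of_small_field`**: `∃ ε₃ > 0` such that for every such `U` with `ε ≤ ε₃`: `0 < re⟨x, Δ_a(U)x⟩` for `x ≠ 0` at
  `B9Eq315QTorus.laplaceAofBackground L m hL φ U hα1 hU1 hreg τ η a` — the displayed `hpos` of the chain, PROVED at every small field;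
  `laplaceAofBackground_pos_of_small_field_unitary` — the same with `hRS` replaced by the model letters of §1b (unitary `U(b)`, tracial `τ`).
* §1b **`hRS_of_unitary`**: `⟨R(U(b))v, u⟩ = ⟨v, R(U(b)⁻¹)u⟩` from `⟨φ⁻¹X, φ⁻¹Y⟩ = τ(X*Y)`, `τ` tracial, `U(b)* = U(b)⁻¹`.
MODEL / DECLARED READINGS.  (M1) as `B9Eq315QTorus`/`B9Thm311SmallFieldCoercivity`.  (M2) displayed: `hRS` (unitarity of `R(U(b))` in the norming
inner product — holds for unitary `U(b)`, a tracial `τ` and `⟨φ⁻¹X, φ⁻¹Y⟩ = τ(X*Y)`, not derived here), the letters `M_φ`, `M_φ′` (bounds of `φ`, `φ⁻¹`),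
`C_τ` (bound of `τ`), `a > 0`, `η ≠ 0`.  (M3) NOT HERE: UNIFORMITY — `γ`, `ε₂`, `ε₃` depend on the lattice (`L`, `m`, `η`, `c₀`, `c₁`) through the flat
constant, the flat modulus, `‖Q(1)‖` and the crude remainder constants; print's Thm 3.11 is uniform («M sufficiently large, α₀ sufficiently small»
independent of the volume) via Thms 3.1–3.10; the GAUGE STEP of p. 416 (small plaquette variables (3.35) ⇒ a gauge with small bond
variables, Sect. B / Cor. 3.6) — the hypothesis here is `‖U(b) − 1‖ ≤ ε` in the GIVEN gauge —; the multi-level (3.16)/(3.24) operators; analyticity.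
HONEST SCOPE.  The junction of [folklore] finite-dimensional perturbation lemmas for the chain's OWN letters; an ESTIMATE-class display of the NE9
chain (`hpos`) becomes a theorem at every small field of a FIXED lattice; NOT summit progress (cell pub-balaban: NE9 NOT PRINTED / NOT PROVED; spine
PROVED 0/9; rung (B)+1 finite T⁴ — NOT infinite volume, NOT mass gap, NOT Clay).  Filed by the pub-balaban NE9 BINDER-row owner lineage
`b2b-balaban-t4-ne9-p1` (gen 80); NEW file importing `B9Thm311SmallFieldCoercivity`, `B9Eq319QprimeLipschitz` (ne9-leaf-03), `B9Eq315QLipschitz`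
(ne9-leaf-04); nothing modified.  Net new unproved facts: 0.
-/

noncomputable section

open scoped InnerProductSpace ComplexConjugate BigOperators

namespace Literature.MathematicalPhysics.QuantumFieldTheory.Balaban1983to89.B9Thm311SmallFieldClosed

open B4Sect5Torus (TSite)
open B9SectCLatticeCarrier (Bond shift)
open B7Prop1Explicit (U1 Wcx boxVec)
open B9Eq311L2Pairing (WL2)
open B9Eq319QprimeTorus (fineP)
open B11Eq103H1Complex (SiteL2K BondL2K laplaceALatticeK)
open B9Eq310HessianOperator (adTransportW principalOpK)
open B9Eq310DeltaPrime (plaqHolU)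
open B9Eq326OperatorAssembly (RofU QprimeW)
open B9Eq315QTorus (perCfg cornerSite QtorusW)
open B9Eq315QTorusOnto (liftSite perSite_liftSite)
open B5Eq172FlatCoercivity (hU1_one hreg_one)
open B9Eq384RemainderLetters (norm_adTransportW_sub_le)
open B9Thm311SmallFieldCoercivity (exists_coercive_principal_of_small_field)
open B9Eq319QprimeLipschitz (norm_QprimeW_sub_flat_le_L2 rho_le)
open B9Eq315QLipschitz (norm_QtorusW_sub_flat_le)

/-! ## §1 A small field has small plaquette variables: `‖U(∂p) − 1‖ ≤ 4ε` on `U1` -/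

section Plaquette

variable {d : ℕ} {Pd : Fin d → ℕ} {𝔸 : Type*} [NormedRing 𝔸] [NormOneClass 𝔸]

omit [NormOneClass 𝔸] in
/-- `‖XY − 1‖ ≤ ‖X − 1‖ + ‖Y − 1‖` when `‖X‖ ≤ 1` (`XY − 1 = X(Y − 1) + (X − 1)`). [folklore] [cite: Balaban1985BackgroundPropagators, (3.5) p.391] -/
theorem norm_mul_sub_one_le {X Y : 𝔸} (hX : ‖X‖ ≤ 1) {s t : ℝ} (hs : ‖X - 1‖ ≤ s) (ht : ‖Y - 1‖ ≤ t) : ‖X * Y - 1‖ ≤ s + t := by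
  rw [show X * Y - 1 = X * (Y - 1) + (X - 1) by noncomm_ring]
  calc ‖X * (Y - 1) + (X - 1)‖ ≤ ‖X * (Y - 1)‖ + ‖X - 1‖ := norm_add_le _ _
    _ ≤ ‖Y - 1‖ + ‖X - 1‖ := by
        have h : ‖X * (Y - 1)‖ ≤ ‖Y - 1‖ := (norm_mul_le _ _).trans (mul_le_of_le_one_left (norm_nonneg _) hX)
        linarith
    _ ≤ s + t := by linarith

/-- **THE PLAQUETTE VARIABLES OF A SMALL FIELD ARE SMALL**: `‖U(∂p) − 1‖ ≤ 4ε` when `‖U(b) − 1‖ ≤ ε` and `U(b) ∈ U1` (unit-bounded with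
unit-bounded inverse; `‖u⁻¹ − 1‖ ≤ ‖u − 1‖`) — the letter `hpl` of `B9Ineq369CurvatureSmall` / `Support/NE9CurChartOfBackground.
cur_chart_exists_of_principal_coercive` READ OFF the bond smallness (print's (3.35): `|U(∂p) − 1| < α₀η²` is an ASSUMPTION on the plaquettes; here the
cruder bond-wise smallness implies it). [cite: Balaban1985BackgroundPropagators, (3.1) p.390, (3.5) p.391, (3.35) p.396] -/
theorem norm_plaqHolU_sub_one_le {U : Bond d Pd → 𝔸ˣ} (hU : ∀ b, U b ∈ U1 𝔸) {ε : ℝ} (hε : ∀ b, ‖(U b : 𝔸) - 1‖ ≤ ε)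
    (p : B9SectCLatticeCarrier.Plaq d Pd) : ‖(plaqHolU U p : 𝔸) - 1‖ ≤ 4 * ε := by
  have h1 : ∀ u : 𝔸ˣ, u ∈ U1 𝔸 → ‖(u : 𝔸)‖ ≤ 1 := fun u hu => (B7Prop1Explicit.mem_U1.1 hu).1
  have hinv : ∀ b, ‖(((U b)⁻¹ : 𝔸ˣ) : 𝔸) - 1‖ ≤ ε := fun b => (B7Prop1Explicit.norm_inv_sub_one_le (hU b)).trans (hε b)
  unfold plaqHolU
  set a := U (p.1, p.2.1.1) with ha
  set b := U (shift p.2.1.1 p.1, p.2.1.2) with hb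
  set c := U (shift p.2.1.2 p.1, p.2.1.1) with hc
  set e := U (p.1, p.2.1.2) with he
  have hab : a * b ∈ U1 𝔸 := (U1 𝔸).mul_mem (hU _) (hU _)
  have habc : a * b * c⁻¹ ∈ U1 𝔸 := (U1 𝔸).mul_mem hab ((U1 𝔸).inv_mem (hU _))
  have h2 : ‖((a * b : 𝔸ˣ) : 𝔸) - 1‖ ≤ ε + ε := by
    rw [Units.val_mul]; exact norm_mul_sub_one_le (h1 _ (hU _)) (hε _) (hε _)
  have h3 : ‖((a * b * c⁻¹ : 𝔸ˣ) : 𝔸) - 1‖ ≤ (ε + ε) + ε := by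
    rw [Units.val_mul]; exact norm_mul_sub_one_le (h1 _ hab) h2 (hinv _)
  have h4 : ‖((a * b * c⁻¹ * e⁻¹ : 𝔸ˣ) : 𝔸) - 1‖ ≤ ((ε + ε) + ε) + ε := by
    rw [Units.val_mul]; exact norm_mul_sub_one_le (h1 _ habc) h3 (hinv _)
  linarith

end Plaquette

/-! ## §1b The display `hRS` from the model letters: unitary bond variables, a tracial `τ` norming the fibre -/

section Unitary

variable {d : ℕ} {Pd : Fin d → ℕ} {𝔸 : Type*} [Ring 𝔸] [StarRing 𝔸] [Algebra ℂ 𝔸]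
  {W : Type*} [NormedAddCommGroup W] [InnerProductSpace ℂ W] (φ : W ≃ₗ[ℂ] 𝔸) (τ : 𝔸 →ₗ[ℂ] ℂ)

/-- **THE MUTUAL ADJOINTNESS `hRS` OF THE TRANSPORTERS FROM THE MODEL LETTERS**: if the fibre's inner product is `⟨φ⁻¹X, φ⁻¹Y⟩ = τ(X*Y)` (the norming
(18) of [Balaban1985Variational], `B9Eq310HessianOperator.inner_eq_sum_trace`'s hypothesis), `τ` is tracial and the bond variables are unitary
(`U(b)* = U(b)⁻¹`), then `⟨R(U(b))v, u⟩ = ⟨v, R(U(b)⁻¹)u⟩` — the display of `B9Eq310HessianOperator.principalOpK_isSymmetric` and of §2/§3 below.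
[cite: Balaban1985BackgroundPropagators, (3.5) p.391, (3.8) p.392; Balaban1985Variational, (18) p.277] -/
theorem hRS_of_unitary (hτφ : ∀ X Y : 𝔸, ⟪φ.symm X, φ.symm Y⟫_ℂ = τ (star X * Y)) (htr : ∀ X Y : 𝔸, τ (X * Y) = τ (Y * X))
    (U : Bond d Pd → 𝔸ˣ) (hU : ∀ b, star (U b : 𝔸) = (((U b)⁻¹ : 𝔸ˣ) : 𝔸)) (b : Bond d Pd) (v u : W) :
    ⟪adTransportW φ U b v, u⟫_ℂ = ⟪v, adTransportW φ (fun b => (U b)⁻¹) b u⟫_ℂ := by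
  have hU' : star (((U b)⁻¹ : 𝔸ˣ) : 𝔸) = U b := by
    calc star (((U b)⁻¹ : 𝔸ˣ) : 𝔸) = star (((U b)⁻¹ : 𝔸ˣ) : 𝔸) * (star (U b : 𝔸) * U b) := by rw [hU, Units.inv_mul, mul_one]
      _ = star ((U b : 𝔸) * ((U b)⁻¹ : 𝔸ˣ)) * U b := by rw [star_mul, mul_assoc]
      _ = U b := by rw [Units.mul_inv, star_one, one_mul]
  rw [B9Eq310HessianOperator.adTransportW_apply, B9Eq310HessianOperator.adTransportW_apply, inv_inv]
  conv_lhs => rw [← φ.symm_apply_apply u]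
  conv_rhs => rw [← φ.symm_apply_apply v]
  rw [hτφ, hτφ, star_mul, star_mul, hU', hU,
    show (U b : 𝔸) * (star (φ v) * (((U b)⁻¹ : 𝔸ˣ) : 𝔸)) * φ u = (U b : 𝔸) * (star (φ v) * (((U b)⁻¹ : 𝔸ˣ) : 𝔸) * φ u) by noncomm_ring,
    htr, show star (φ v) * (((U b)⁻¹ : 𝔸ˣ) : 𝔸) * φ u * (U b : 𝔸) = star (φ v) * ((((U b)⁻¹ : 𝔸ˣ) : 𝔸) * φ u * (U b : 𝔸)) by noncomm_ring]

end Unitary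

/-! ## §2 [B9] Thm 3.11's second half at a fixed lattice with BOTH averaging remainders discharged by the NE9 leaves' letters -/

section Closed

variable {d : ℕ} (L : ℕ) [NeZero L] (m : Fin d → ℕ) [∀ i, NeZero (fineP L m i)] (hL : 1 ≤ L)
  {𝔸 : Type*} [NormedRing 𝔸] [NormedAlgebra ℂ 𝔸] [CompleteSpace 𝔸] [NormOneClass 𝔸]
  {W : Type*} [NormedAddCommGroup W] [InnerProductSpace ℂ W] [FiniteDimensional ℂ W] (φ : W ≃ₗ[ℂ] 𝔸) {c₀ c₁ : ℝ} [Fact (0 < c₀)] [Fact (0 < c₁)]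

/-- **[B9] THM 3.11, SECOND HALF, AT A FIXED LATTICE — NO DISPLAYED REMAINDER**: there are `γ, ε₂ > 0` (finite-lattice numbers) such that for
EVERY background `U` of E162's data whose field is `ε`-small with `ε ≤ ε₂` (`‖U(b) − 1‖ ≤ ε`) and whose transporters are mutually adjoint in the
norming inner product (`hRS`, the display of `B9Eq310HessianOperator.principalOpK_isSymmetric`):
`γ‖x‖² ≤ re⟨x, (D*D + DR(U)D* + aQ(U)*Q(U))x⟩` — the `hγ` of `Support/NE9CurChartOfBackground.cur_chart_exists_of_principal_coercive`.  The two
averaging remainders of `B9Thm311SmallFieldCoercivity.exists_coercive_principal_of_small_field` are DISCHARGED by the NE9 leaves' letters: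
`ρ′ := ((1+εR)^{d(L−1)} − 1)/√c₀` (`B9Eq319QprimeLipschitz.norm_QprimeW_sub_flat_le_L2`, ne9-leaf-03) and
`δ_Q := M_φ′M_φ√(c₁·#bonds/c₀)·102(d+1)²L·ε` (`B9Eq315QLipschitz.norm_QtorusW_sub_flat_le`, ne9-leaf-04); `εR := 2M_φM_φ′ε`
(`B9Eq384RemainderLetters.norm_adTransportW_sub_le`); `U(b) ∈ U1` is READ OFF E162's `hU1` (`B9Eq315QTorusOnto.perSite_liftSite`).
[cite: Balaban1985BackgroundPropagators, Thm 3.11 p.416, (3.78)–(3.86) pp.406–407; Balaban1984PropagatorsI, (1.72) p.30; Balaban1985Averaging, (124) p.36] -/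
theorem exists_coercive_principal_of_small_field₀ {η : ℝ} (hη : η ≠ 0) {a : ℝ} (ha : 0 < a) {Mφ Mφ' : ℝ} (hMφ : 0 ≤ Mφ) (hMφ' : 0 ≤ Mφ')
    (hφ : ∀ w, ‖φ w‖ ≤ Mφ * ‖w‖) (hφ' : ∀ X, ‖φ.symm X‖ ≤ Mφ' * ‖X‖) :
    ∃ γ ε₂ : ℝ, 0 < γ ∧ 0 < ε₂ ∧ ∀ (U : Bond d (fineP L m) → 𝔸ˣ) {α : ℝ} (hα1 : α ≤ 1 / 64)
      (hU1 : ∀ (x : B7Prop1Explicit.Site d) (κ : Fin d), perCfg (fineP L m) U x κ ∈ U1 𝔸)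
      (hreg : ∀ (y : TSite d m) (κ : Fin d) (r : Fin d → Fin L), ‖((Wcx L (perCfg (fineP L m) U) (cornerSite L y) κ (boxVec L r) : 𝔸ˣ) : 𝔸) - 1‖ ≤ α)
      {ε : ℝ}, 0 ≤ ε → ε ≤ ε₂ → (∀ b, ‖(U b : 𝔸) - 1‖ ≤ ε) →
      (∀ (b : Bond d (fineP L m)) (v u : W), ⟪adTransportW φ U b v, u⟫_ℂ = ⟪v, adTransportW φ (fun b => (U b)⁻¹) b u⟫_ℂ) →
      ∀ x : BondL2K ℂ d (fineP L m) c₀ W, γ * ‖x‖ ^ 2 ≤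
        RCLike.re ⟪x, laplaceALatticeK ((η : ℂ))⁻¹ (adTransportW φ U) (adTransportW φ fun b => (U b)⁻¹) (principalOpK φ η U) (RofU L m φ η U)
          (QtorusW L m hL φ U hα1 hU1 hreg (c₁ := c₁)) a x⟫_ℂ := by
  have hc₀ : 0 < c₀ := Fact.out
  obtain ⟨γ, ε₀, hγ, hε₀, H⟩ := exists_coercive_principal_of_small_field L m hL φ (c₀ := c₀) (c₁ := c₁) hη ha hMφ hMφ' hφ hφ'
  -- the three linear rates: `εR = KR·ε`, `ρ′ ≤ Cρ·εR` (for `εR ≤ 1`), `δ_Q = CQ·ε`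
  obtain ⟨KR, hKRdef⟩ : ∃ KR : ℝ, KR = 2 * Mφ * Mφ' := ⟨_, rfl⟩
  have hKR : 0 ≤ KR := by rw [hKRdef]; positivity
  obtain ⟨Cρ, hCρdef⟩ : ∃ Cρ : ℝ, Cρ = (d * (L - 1) : ℕ) * 2 ^ (d * (L - 1)) * (Real.sqrt c₀)⁻¹ := ⟨_, rfl⟩
  have hCρ : 0 ≤ Cρ := by rw [hCρdef]; positivity
  obtain ⟨CQ, hCQdef⟩ : ∃ CQ : ℝ, CQ = Mφ' * Mφ * Real.sqrt (c₁ * Fintype.card (Bond d m) / c₀) * (102 * (d + 1) ^ 2 * L) := ⟨_, rfl⟩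
  have hCQ : 0 ≤ CQ := by rw [hCQdef]; positivity
  refine ⟨γ, min (1 / (KR + 1)) (ε₀ / (1 + Cρ * KR + CQ)), hγ, by positivity, ?_⟩
  intro U α hα1 hU1 hreg ε hε hε₂ hUε hRS x
  have ht1 : ε ≤ 1 / (KR + 1) := hε₂.trans (min_le_left _ _)
  have ht2 : ε ≤ ε₀ / (1 + Cρ * KR + CQ) := hε₂.trans (min_le_right _ _)
  -- `U(b) ∈ U1` read off the periodic extension
  have hUb : ∀ b : Bond d (fineP L m), U b ∈ U1 𝔸 := fun b => by
    obtain ⟨y, κ⟩ := b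
    have h := hU1 (liftSite y) κ
    rwa [B9Eq315QTorus.perCfg_apply, perSite_liftSite] at h
  -- the transporters
  have hR : ∀ (b : Bond d (fineP L m)) (w : W), ‖adTransportW φ U b w - w‖ ≤ KR * ε * ‖w‖ := fun b w => by
    have h := norm_adTransportW_sub_le φ hφ hφ' hMφ' U b (hUb b) (hUε b) w
    rw [hKRdef]; linarith
  have hεR0 : 0 ≤ KR * ε := by positivity
  have hεR1 : KR * ε ≤ 1 := by
    refine (mul_le_mul_of_nonneg_left ht1 hKR).trans ?_
    rw [mul_one_div, div_le_one (by positivity)]; linarith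
  -- (ρ′) by ne9-leaf-03
  have hρ' : (1 + KR * ε) ^ (d * (L - 1)) - 1 ≤ Cρ * Real.sqrt c₀ * (KR * ε) := by
    have h := rho_le L (d := d) hεR0
    have h2 : (1 + KR * ε) ^ (d * (L - 1)) ≤ 2 ^ (d * (L - 1)) := pow_le_pow_left₀ (by positivity) (by linarith) _
    have hs : Cρ * Real.sqrt c₀ = (d * (L - 1) : ℕ) * 2 ^ (d * (L - 1)) := by
      rw [hCρdef, mul_assoc, inv_mul_cancel₀ (Real.sqrt_pos.2 hc₀).ne', mul_one]
    rw [hs]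
    calc (1 + KR * ε) ^ (d * (L - 1)) - 1 ≤ (d * (L - 1) : ℕ) * (KR * ε) * (1 + KR * ε) ^ (d * (L - 1)) := h
      _ ≤ (d * (L - 1) : ℕ) * (KR * ε) * 2 ^ (d * (L - 1)) := mul_le_mul_of_nonneg_left h2 (by positivity)
      _ = (d * (L - 1) : ℕ) * 2 ^ (d * (L - 1)) * (KR * ε) := by ring
  have hQ' : ∀ l : SiteL2K ℂ d (fineP L m) c₀ W,
      ‖QprimeW L m φ U l - QprimeW L m φ (fun _ : Bond d (fineP L m) => (1 : 𝔸ˣ)) l‖ ≤ Cρ * (KR * ε) * ‖l‖ := fun l => by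
    refine (norm_QprimeW_sub_flat_le_L2 L m φ U hεR0 hR l).trans ?_
    rw [← mul_assoc]
    refine mul_le_mul_of_nonneg_right ?_ (norm_nonneg _)
    have hs0 : 0 < Real.sqrt c₀ := Real.sqrt_pos.2 hc₀
    calc ((1 + KR * ε) ^ (d * (L - 1)) - 1) * (Real.sqrt c₀)⁻¹ ≤ (Cρ * Real.sqrt c₀ * (KR * ε)) * (Real.sqrt c₀)⁻¹ :=
          mul_le_mul_of_nonneg_right hρ' (by positivity)
      _ = Cρ * (KR * ε) := by field_simp
  -- (δ_Q) by ne9-leaf-04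
  have hQ : ∀ y : BondL2K ℂ d (fineP L m) c₀ W, ‖QtorusW L m hL φ U hα1 hU1 hreg (c₁ := c₁) y -
      QtorusW L m hL φ (fun _ => 1) (show (0 : ℝ) ≤ 1 / 64 by norm_num) (hU1_one L m) (hreg_one L m) (c₁ := c₁) y‖ ≤ CQ * ε * ‖y‖ := fun y => by
    refine (norm_QtorusW_sub_flat_le L m hL U hα1 hU1 hreg (show (0 : ℝ) ≤ 1 / 64 by norm_num) (hU1_one L m) (hreg_one L m) hε hUε φ
      hMφ hφ hMφ' hφ' y).trans (le_of_eq ?_)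
    rw [hCQdef]; ring
  -- the budget `ε + ρ′ + δ_Q ≤ ε₀`
  have hbudget : ε + Cρ * (KR * ε) + CQ * ε ≤ ε₀ := by
    have h1 : ε + Cρ * (KR * ε) + CQ * ε = ε * (1 + Cρ * KR + CQ) := by ring
    have h2 : ε * (1 + Cρ * KR + CQ) ≤ ε₀ := by
      have := mul_le_mul_of_nonneg_right ht2 (by positivity : (0 : ℝ) ≤ 1 + Cρ * KR + CQ)
      rwa [div_mul_cancel₀ _ (by positivity : (1 + Cρ * KR + CQ) ≠ 0)] at this
    rw [h1]; exact h2
  exact H U hα1 hU1 hreg hε (by positivity) (by positivity) hbudget hUb hUε hRS hQ' hQ x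

end Closed

/-! ## §3 [B9] THM 3.11 ITSELF FOR THE CHAIN'S ASSEMBLED `Δ_a(U)` AT EVERY SMALL FIELD: the displayed `hpos` of the NE9 letters is a THEOREM -/

section Hpos

open B9Eq315QTorus (laplaceAofBackground)
open B9Ineq369CurvatureSmall (hpos_of_smallCurvature)

variable {d : ℕ} (L : ℕ) [NeZero L] (m : Fin d → ℕ) [∀ i, NeZero (fineP L m i)] (hL : 1 ≤ L)
  {𝔸 : Type*} [NormedRing 𝔸] [NormedAlgebra ℂ 𝔸] [CompleteSpace 𝔸] [NormOneClass 𝔸] [StarRing 𝔸] [NormedStarGroup 𝔸] [StarModule ℂ 𝔸]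
  {W : Type*} [NormedAddCommGroup W] [InnerProductSpace ℂ W] [FiniteDimensional ℂ W] (φ : W ≃ₗ[ℂ] 𝔸) {c₀ c₁ : ℝ} [Fact (0 < c₀)] [Fact (0 < c₁)]

/-- **[B9] THM 3.11 «Δ_a IS POSITIVE DEFINITE» FOR THE NE9 CHAIN'S ASSEMBLED `Δ_a(U)` AT EVERY SMALL FIELD, AT A FIXED LATTICE**: there is
`ε₃ > 0` (a finite-lattice number) such that for EVERY background `U` of E162's data with `‖U(b) − 1‖ ≤ ε ≤ ε₃` and mutually adjoint transporters
(`hRS`), the displayed `hpos` of `B9Eq315QTorus.laplaceAofBackground` / `Support/NE9CurChartOfBackground.cur_chart_exists_of_W(_H126)` HOLDS: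
`0 < re⟨x, Δ_a(U)x⟩` for `x ≠ 0` — §2's coercivity `γ` of the principal part + the smallness of the curvature part `Δ′(U)`
(`B9Ineq369CurvatureSmall.hpos_of_smallCurvature`, plaquettes `4ε`-close to `1` by §1) once `128d·C_τ·M_φ²·(|η|^d/c₀)·|η|⁻²·ε < γ`.  Displayed: `hRS`,
the trace/fibre letters `C_τ`, `M_φ`, `M_φ′`.  NOT print's uniform statement. [cite: Balaban1985BackgroundPropagators, Thm 3.11 p.416, (3.69) p.404, (3.82)–(3.86) p.407] -/
theorem laplaceAofBackground_pos_of_small_field {η : ℝ} (hη : η ≠ 0) {a : ℝ} (ha : 0 < a) {Mφ Mφ' : ℝ} (hMφ : 0 ≤ Mφ) (hMφ' : 0 ≤ Mφ')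
    (hφ : ∀ w, ‖φ w‖ ≤ Mφ * ‖w‖) (hφ' : ∀ X, ‖φ.symm X‖ ≤ Mφ' * ‖X‖) (τ : 𝔸 →ₗ[ℂ] ℂ) {Cτ : ℝ} (hτ : ∀ X, ‖τ X‖ ≤ Cτ * ‖X‖) (hCτ : 0 ≤ Cτ) :
    ∃ ε₃ : ℝ, 0 < ε₃ ∧ ∀ (U : Bond d (fineP L m) → 𝔸ˣ) {α : ℝ} (hα1 : α ≤ 1 / 64)
      (hU1 : ∀ (x : B7Prop1Explicit.Site d) (κ : Fin d), perCfg (fineP L m) U x κ ∈ U1 𝔸)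
      (hreg : ∀ (y : TSite d m) (κ : Fin d) (r : Fin d → Fin L), ‖((Wcx L (perCfg (fineP L m) U) (cornerSite L y) κ (boxVec L r) : 𝔸ˣ) : 𝔸) - 1‖ ≤ α)
      {ε : ℝ}, 0 ≤ ε → ε ≤ ε₃ → (∀ b, ‖(U b : 𝔸) - 1‖ ≤ ε) →
      (∀ (b : Bond d (fineP L m)) (v u : W), ⟪adTransportW φ U b v, u⟫_ℂ = ⟪v, adTransportW φ (fun b => (U b)⁻¹) b u⟫_ℂ) →
      ∀ x : BondL2K ℂ d (fineP L m) c₀ W, x ≠ 0 →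
        0 < RCLike.re ⟪x, laplaceAofBackground L m hL φ U hα1 hU1 hreg τ η (c₀ := c₀) (c₁ := c₁) a x⟫_ℂ := by
  have hc₀ : 0 < c₀ := Fact.out
  obtain ⟨γ, ε₂, hγ, hε₂, H⟩ := exists_coercive_principal_of_small_field₀ L m hL φ (c₀ := c₀) (c₁ := c₁) hη ha hMφ hMφ' hφ hφ'
  obtain ⟨Kc, hKcdef⟩ : ∃ Kc : ℝ, Kc = 32 * d * Cτ * Mφ ^ 2 * (|η| ^ d / c₀) * (‖((η : ℂ))⁻¹‖ ^ 2 * 4) := ⟨_, rfl⟩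
  have hKc : 0 ≤ Kc := by rw [hKcdef]; positivity
  refine ⟨min ε₂ (γ / (Kc + 1) / 2), by positivity, ?_⟩
  intro U α hα1 hU1 hreg ε hε hε₃ hUε hRS x hx
  have hUb : ∀ b : Bond d (fineP L m), ‖(U b : 𝔸)‖ ≤ 1 ∧ ‖(((U b)⁻¹ : 𝔸ˣ) : 𝔸)‖ ≤ 1 := fun b => by
    obtain ⟨y, κ⟩ := b
    have h := hU1 (liftSite y) κ
    rw [B9Eq315QTorus.perCfg_apply, perSite_liftSite] at h
    exact B7Prop1Explicit.mem_U1.1 h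
  have hpl : ∀ p : B9SectCLatticeCarrier.Plaq d (fineP L m), ‖(plaqHolU U p : 𝔸) - 1‖ ≤ 4 * ε :=
    norm_plaqHolU_sub_one_le (fun b => B7Prop1Explicit.mem_U1.2 (hUb b)) hUε
  have hγU := H U hα1 hU1 hreg hε (hε₃.trans (min_le_left _ _)) hUε hRS
  -- the curvature constant `Kc·ε < γ`
  have hsmall : 32 * d * Cτ * Mφ ^ 2 * (|η| ^ d / c₀) * (‖((η : ℂ))⁻¹‖ ^ 2 * (4 * ε)) < γ := by
    have h1 : 32 * d * Cτ * Mφ ^ 2 * (|η| ^ d / c₀) * (‖((η : ℂ))⁻¹‖ ^ 2 * (4 * ε)) = Kc * ε := by rw [hKcdef]; ring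
    rw [h1]
    have h2 : ε ≤ γ / (Kc + 1) / 2 := hε₃.trans (min_le_right _ _)
    have h3 : Kc * ε ≤ Kc * (γ / (Kc + 1) / 2) := mul_le_mul_of_nonneg_left h2 hKc
    have h4 : Kc * (γ / (Kc + 1) / 2) < γ := by
      rw [mul_div_assoc', mul_div_assoc', div_div, div_lt_iff₀ (by positivity)]
      nlinarith
    exact h3.trans_lt h4
  exact hpos_of_smallCurvature φ hτ hCτ hφ η hUb hpl (by positivity) _ _ _ _ _ a hγU hsmall x hx

/-- **THE SAME WITH `hRS` DISCHARGED BY THE MODEL LETTERS** (§1b `hRS_of_unitary`): for unitary bond variables (`U(b)* = U(b)⁻¹`), a tracial `τ`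
and the norming `⟨φ⁻¹X, φ⁻¹Y⟩ = τ(X*Y)`, Thm 3.11 holds for the chain's assembled `Δ_a(U)` at every small field of a fixed lattice with NO displayed
operator hypothesis. [cite: Balaban1985BackgroundPropagators, Thm 3.11 p.416, (3.5) p.391; Balaban1985Variational, (18) p.277] -/
theorem laplaceAofBackground_pos_of_small_field_unitary {η : ℝ} (hη : η ≠ 0) {a : ℝ} (ha : 0 < a) {Mφ Mφ' : ℝ} (hMφ : 0 ≤ Mφ)
    (hMφ' : 0 ≤ Mφ') (hφ : ∀ w, ‖φ w‖ ≤ Mφ * ‖w‖) (hφ' : ∀ X, ‖φ.symm X‖ ≤ Mφ' * ‖X‖) (τ : 𝔸 →ₗ[ℂ] ℂ) {Cτ : ℝ}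
    (hτ : ∀ X, ‖τ X‖ ≤ Cτ * ‖X‖) (hCτ : 0 ≤ Cτ) (hτφ : ∀ X Y : 𝔸, ⟪φ.symm X, φ.symm Y⟫_ℂ = τ (star X * Y))
    (htr : ∀ X Y : 𝔸, τ (X * Y) = τ (Y * X)) :
    ∃ ε₃ : ℝ, 0 < ε₃ ∧ ∀ (U : Bond d (fineP L m) → 𝔸ˣ) {α : ℝ} (hα1 : α ≤ 1 / 64)
      (hU1 : ∀ (x : B7Prop1Explicit.Site d) (κ : Fin d), perCfg (fineP L m) U x κ ∈ U1 𝔸)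
      (hreg : ∀ (y : TSite d m) (κ : Fin d) (r : Fin d → Fin L), ‖((Wcx L (perCfg (fineP L m) U) (cornerSite L y) κ (boxVec L r) : 𝔸ˣ) : 𝔸) - 1‖ ≤ α)
      {ε : ℝ}, 0 ≤ ε → ε ≤ ε₃ → (∀ b, ‖(U b : 𝔸) - 1‖ ≤ ε) → (∀ b, star (U b : 𝔸) = (((U b)⁻¹ : 𝔸ˣ) : 𝔸)) →
      ∀ x : BondL2K ℂ d (fineP L m) c₀ W, x ≠ 0 →
        0 < RCLike.re ⟪x, laplaceAofBackground L m hL φ U hα1 hU1 hreg τ η (c₀ := c₀) (c₁ := c₁) a x⟫_ℂ := by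
  obtain ⟨ε₃, hε₃, H⟩ := laplaceAofBackground_pos_of_small_field L m hL φ (c₀ := c₀) (c₁ := c₁) hη ha hMφ hMφ' hφ hφ' τ hτ hCτ
  exact ⟨ε₃, hε₃, fun U α hα1 hU1 hreg ε hε hεε₃ hUε hUstar x hx =>
    H U hα1 hU1 hreg hε hεε₃ hUε (hRS_of_unitary φ τ hτφ htr U hUstar) x hx⟩

end Hpos


end Literature.MathematicalPhysics.QuantumFieldTheory.Balaban1983to89.B9Thm311SmallFieldClosed

end
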